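import Mathlib
import HarnessLib
import Summits.Langlands.Langlands.Theorems.NonParallelVoidTensorSquareParallelStubResidualIrreducibilityForm

/-!
# Stub `stub_residualIrreducibility` of crux `TensorSquareParallel` (stmt-Langlands-17009), helper 3:
# a conjugate representation which is a twist on a sub(normal)group is a twist — Clifford theory

Step B of the stub.  Setting: `i : Λ → G` a homomorphism whose image is normalised by `G` — in
the sense that every inner automorphism of `G` restricts along `i` to an endomorphism of `Λ`
(`∀ g, ∃ κ : Λ → Λ, i ∘ κ = Int(g⁻¹) ∘ i`; for `Λ = Γ_{F(ζ_p)} ↪ G = Γ_F` this is the outer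
action `absGaloisOuterConj`), `θ : G → G` an endomorphism (the outer conjugation of `Γ_F` by
`τ ∈ Γ_ℚ ∖ Γ_F`), `r : G → GL₂(k)` over an algebraically closed field `k` whose restriction
`V = r ∘ i` has no common eigenvector and is NON-DIHEDRAL in trace form (no character `η ≠ 1` of
`Λ` with `tr V = η · tr V`).  **If the conjugate `r^θ ∘ i` is conjugate to a twist `χ ⊗ V`
(`χ : Λ → kˣ`), then `r^θ` itself is conjugate to a twist `χ' ⊗ r` by a character `χ'` of `G`**
(`stub_residualIrreducibility_twist`): the non-dihedral hypothesis makes `χ` `G`-invariant,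
Schur's lemma (`exists_eq_smul_one_of_forall_commute`) then makes `r(θg) P r(g)⁻¹ P⁻¹` a scalar,
and the scalars form a character (`exists_character_of_forall_exists_smul`, helper 1).  In the
stub this converts "`ρ̄^τ|_{Γ_{F(ζ_p)}}` is a twist of `ρ̄|_{Γ_{F(ζ_p)}}`" into the excluded
base-change-type identities `tr ρ̄(τστ⁻¹) = χ'(σ) tr ρ̄(σ)`, `det ρ̄(τστ⁻¹) = χ'(σ)² det ρ̄(σ)`.

## References

* A. H. Clifford, *Representations induced in an invariant subgroup*, Ann. of Math. 38 (1937),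
  §§2–3. [Clifford1937]
* J.-P. Serre, *Linear representations of finite groups*, §2.2 (Schur), §8.1.
* [Calegari2010] F. Calegari, Invent. Math. 185 (2011), §2, §6 — the application.
-/

set_option linter.dupNamespace false

noncomputable section

namespace Summit.Langlands.Langlands.Theorems.TensorSquareParallel

open scoped MatrixGroups
open Matrix Module

variable {k : Type*} [Field k] {Λ : Type*}

/-- **Schur's lemma for `GL₂` (matrix form).**  Over an algebraically closed field, a matrix
commuting with a family of invertible `2 × 2` matrices without common eigenvector is scalar: an
eigenvector `u` of `M` (eigenvalue `c`) and some `V(λ) u ∉ k u` are two independent vectors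
killed by `M − c`. [folklore] -/
theorem exists_eq_smul_one_of_forall_commute [IsAlgClosed k] (V : Λ → GL (Fin 2) k)
    (hV : ∀ v : Fin 2 → k, v ≠ 0 → ∃ x, ((V x : GL (Fin 2) k) : Matrix (Fin 2) (Fin 2) k) *ᵥ v ∉ k ∙ v)
    (M : Matrix (Fin 2) (Fin 2) k)
    (hM : ∀ x, ((V x : GL (Fin 2) k) : Matrix (Fin 2) (Fin 2) k) * M =
      M * ((V x : GL (Fin 2) k) : Matrix (Fin 2) (Fin 2) k)) :
    ∃ c : k, M = c • (1 : Matrix (Fin 2) (Fin 2) k) := by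
  -- an eigenvalue `c` and an eigenvector `u` of `M`
  obtain ⟨c, hc⟩ := IsAlgClosed.exists_root M.charpoly
    (by rw [Matrix.charpoly_degree_eq_dim]; simp)
  rw [Polynomial.IsRoot.def, Matrix.eval_charpoly, Matrix.scalar_apply,
    ← Matrix.smul_one_eq_diagonal] at hc
  obtain ⟨u, hu, hNu⟩ := Matrix.exists_mulVec_eq_zero_iff.mpr hc
  set N : Matrix (Fin 2) (Fin 2) k := c • (1 : Matrix (Fin 2) (Fin 2) k) - M with hN
  have hNcomm : ∀ x, ((V x : GL (Fin 2) k) : Matrix (Fin 2) (Fin 2) k) * N =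
      N * ((V x : GL (Fin 2) k) : Matrix (Fin 2) (Fin 2) k) := fun x => by
    rw [hN, Matrix.mul_sub, Matrix.sub_mul, Matrix.mul_smul, Matrix.smul_mul, Matrix.mul_one,
      Matrix.one_mul, hM x]
  -- a second vector `w = V(x) u ∉ k u` killed by `N`
  obtain ⟨x, hx⟩ := hV u hu
  set w := ((V x : GL (Fin 2) k) : Matrix (Fin 2) (Fin 2) k) *ᵥ u with hw
  have hNw : N *ᵥ w = 0 := by
    rw [hw, Matrix.mulVec_mulVec, ← hNcomm, ← Matrix.mulVec_mulVec, hNu, Matrix.mulVec_zero]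
  have hd : u 0 * w 1 - u 1 * w 0 ≠ 0 := fun h => hx (mem_span_of_det_two_eq_zero hu h)
  -- `N` kills the basis `(u, w)`, hence vanishes
  set Q : Matrix (Fin 2) (Fin 2) k := !![u 0, w 0; u 1, w 1] with hQ
  have hQdet : Q.det ≠ 0 := by rw [hQ, Matrix.det_fin_two_of]; intro h; apply hd; linear_combination h
  have hNQ : N * Q = 0 := by
    have h0 := congr_fun hNu
    have h1 := congr_fun hNw
    simp only [Matrix.mulVec, dotProduct, Fin.sum_univ_two, Pi.zero_apply] at h0 h1
    ext i j
    fin_cases i <;> fin_cases j <;>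
      simp [hQ, Matrix.mul_apply, Fin.sum_univ_two, h0 0, h0 1, h1 0, h1 1]
  have hN0 : N = 0 := by
    have : N * Q * Q⁻¹ = N := by
      rw [Matrix.mul_assoc, Matrix.mul_nonsing_inv _ (Ne.isUnit hQdet), Matrix.mul_one]
    rw [← this, hNQ, Matrix.zero_mul]
  refine ⟨c, ?_⟩
  rw [hN, sub_eq_zero] at hN0
  exact hN0.symm

/-- Traces of a conjugate-twist: `tr (c • Q V Q⁻¹) = c tr V`. [folklore] -/
theorem trace_smul_units_conj (c : k) (Q V : GL (Fin 2) k) :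
    ((c • ((Q * V * Q⁻¹ : GL (Fin 2) k) : Matrix (Fin 2) (Fin 2) k)) : Matrix (Fin 2) (Fin 2) k).trace =
      c * ((V : GL (Fin 2) k) : Matrix (Fin 2) (Fin 2) k).trace := by
  rw [Matrix.trace_smul, Units.val_mul, Units.val_mul, Matrix.trace_units_conj, smul_eq_mul]

/-- **Step B: a conjugate which is a twist on `Λ` is a twist on `G`** (the registered sub-goal
this helper file proves).  Let `i : Λ → G` have image stable under the inner automorphisms of `G`
(`∀ g, ∃ κ, i ∘ κ = Int(g⁻¹) ∘ i`), `θ : G → G` an endomorphism, `r : G → GL₂(k)` (`k`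
algebraically closed) with `V = r ∘ i` without common eigenvector and non-dihedral in trace form.
If `r ∘ θ ∘ i = χ ⊗ P V P⁻¹` for a character `χ` of `Λ`, then `r ∘ θ = χ' ⊗ P r P⁻¹` for a
character `χ'` of `G`.  Proof: for `g ∈ G` and `ψ = r(θg) P r(g)⁻¹`, conjugating by `g` gives
`r ∘ θ ∘ i = (χ ∘ κ) ⊗ ψ V ψ⁻¹`; comparing traces, `tr V · (χ∘κ)/χ = tr V`, so `χ ∘ κ = χ` by
non-dihedrality; then `P⁻¹ψ` commutes with `V`, hence is a scalar (Schur), i.e.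
`r(θ g) = c_g · P r(g) P⁻¹`, and `g ↦ c_g` is a character. [cite: Clifford1937, §§2–3] -/
theorem stub_residualIrreducibility_twist : ∀ (k : Type) [Field k] [IsAlgClosed k] (G Λ : Type) [Group G] [Group Λ] (i : Λ →* G) (θ : G →* G) (r : G →* GL (Fin 2) k), (∀ g : G, ∃ κ : Λ →* Λ, ∀ x, i (κ x) = g⁻¹ * i x * g) → (∀ v : Fin 2 → k, v ≠ 0 → ∃ x, (r (i x)).val.mulVec v ∉ k ∙ v) → (¬ ∃ η : Λ →* kˣ, η ≠ 1 ∧ ∀ x, (r (i x)).val.trace = (η x : k) * (r (i x)).val.trace) → (∃ (χ : Λ →* kˣ) (P : GL (Fin 2) k), ∀ x, (r (θ (i x))).val = (χ x : k) • (P * r (i x) * P⁻¹).val) → ∃ (χ' : G →* kˣ) (P : GL (Fin 2) k), ∀ g, (r (θ g)).val = (χ' g : k) • (P * r g * P⁻¹).val := by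
  intro k _ _ G Λ _ _ i θ r hκ hV hi hχP
  obtain ⟨χ, P, hχ⟩ := hχP
  -- it suffices to produce the scalars
  suffices h : ∀ g, ∃ c : k, ((r.comp θ g : GL (Fin 2) k) : Matrix (Fin 2) (Fin 2) k) =
      c • (((P * r g * P⁻¹ : GL (Fin 2) k)) : Matrix (Fin 2) (Fin 2) k) by
    obtain ⟨χ', hχ'⟩ := exists_character_of_forall_exists_smul r (r.comp θ) P h
    exact ⟨χ', P, hχ'⟩
  intro g
  rw [MonoidHom.comp_apply]
  obtain ⟨κ, hκg⟩ := hκ g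
  set ψ : GL (Fin 2) k := r (θ g) * P * (r g)⁻¹ with hψ
  -- (1) conjugating the twist relation by `g`
  have h1 : ∀ x, ((r (θ (i x)) : GL (Fin 2) k) : Matrix (Fin 2) (Fin 2) k) =
      (χ (κ x) : k) • (((ψ * r (i x) * ψ⁻¹ : GL (Fin 2) k)) : Matrix (Fin 2) (Fin 2) k) := by
    intro x
    have hix : i x = g * i (κ x) * g⁻¹ := by rw [hκg]; group
    have e1 : r (θ (i x)) = r (θ g) * r (θ (i (κ x))) * (r (θ g))⁻¹ := by
      conv_lhs => rw [hix]
      simp only [map_mul, map_inv]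
    have e2 : r (i (κ x)) = (r g)⁻¹ * r (i x) * r g := by
      rw [hκg]; simp only [map_mul, map_inv]
    have key : (r (θ g) * (P * r (i (κ x)) * P⁻¹) * (r (θ g))⁻¹ : GL (Fin 2) k) =
        ψ * r (i x) * ψ⁻¹ := by
      rw [e2, hψ]; group
    calc ((r (θ (i x)) : GL (Fin 2) k) : Matrix (Fin 2) (Fin 2) k)
        = ((r (θ g) : GL (Fin 2) k) : Matrix (Fin 2) (Fin 2) k) *
            ((r (θ (i (κ x))) : GL (Fin 2) k) : Matrix (Fin 2) (Fin 2) k) *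
            (((r (θ g))⁻¹ : GL (Fin 2) k) : Matrix (Fin 2) (Fin 2) k) := by
          rw [e1, Units.val_mul, Units.val_mul]
      _ = (χ (κ x) : k) • (((r (θ g) * (P * r (i (κ x)) * P⁻¹) * (r (θ g))⁻¹ : GL (Fin 2) k)) :
            Matrix (Fin 2) (Fin 2) k) := by
          rw [hχ (κ x), Matrix.mul_smul, Matrix.smul_mul]
          simp only [Units.val_mul]
      _ = _ := by rw [key]
  -- (2) `χ ∘ κ = χ` on the support of `tr V`, hence everywhere (non-dihedral)
  have h2 : ∀ x, χ (κ x) = χ x := by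
    by_contra hne
    push Not at hne
    obtain ⟨x₀, hx₀⟩ := hne
    apply hi
    refine ⟨(χ.comp κ) / χ, fun h => hx₀ ?_, fun x => ?_⟩
    · have := DFunLike.congr_fun h x₀
      rw [MonoidHom.div_apply, MonoidHom.comp_apply, MonoidHom.one_apply, div_eq_one] at this
      exact this
    · have t1 := congrArg Matrix.trace (h1 x)
      have t2 := congrArg Matrix.trace (hχ x)
      rw [trace_smul_units_conj] at t1 t2
      rw [MonoidHom.div_apply, MonoidHom.comp_apply, Units.val_div_eq_div_val, div_mul_eq_mul_div,
        eq_div_iff (Units.ne_zero _), mul_comm _ ((χ x : kˣ) : k), ← t2, ← t1]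
  -- (3) `P⁻¹ ψ` commutes with `V`, hence is a scalar
  have h3 : ∀ x, ((r (i x) : GL (Fin 2) k) : Matrix (Fin 2) (Fin 2) k) *
      (((P⁻¹ * ψ : GL (Fin 2) k)) : Matrix (Fin 2) (Fin 2) k) =
      (((P⁻¹ * ψ : GL (Fin 2) k)) : Matrix (Fin 2) (Fin 2) k) *
        ((r (i x) : GL (Fin 2) k) : Matrix (Fin 2) (Fin 2) k) := by
    intro x
    have e := (hχ x).symm.trans (h1 x)
    rw [h2 x] at e
    have e' : (((P * r (i x) * P⁻¹ : GL (Fin 2) k)) : Matrix (Fin 2) (Fin 2) k) =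
        (((ψ * r (i x) * ψ⁻¹ : GL (Fin 2) k)) : Matrix (Fin 2) (Fin 2) k) := by
      have := congrArg (fun M : Matrix (Fin 2) (Fin 2) k => ((χ x)⁻¹ : kˣ).val • M) e
      simpa only [smul_smul, Units.inv_mul, one_smul] using this
    have e'' : P * r (i x) * P⁻¹ = ψ * r (i x) * ψ⁻¹ := Units.ext e'
    have e3 : r (i x) * (P⁻¹ * ψ) = (P⁻¹ * ψ) * r (i x) := by
      calc r (i x) * (P⁻¹ * ψ) = P⁻¹ * (P * r (i x) * P⁻¹) * ψ := by group
        _ = P⁻¹ * (ψ * r (i x) * ψ⁻¹) * ψ := by rw [e'']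
        _ = (P⁻¹ * ψ) * r (i x) := by group
    have := congrArg (fun u : GL (Fin 2) k => (u : Matrix (Fin 2) (Fin 2) k)) e3
    simpa only [Units.val_mul] using this
  obtain ⟨c, hc⟩ := exists_eq_smul_one_of_forall_commute (fun x => r (i x)) hV _ h3
  -- (4) `r(θ g) = c • P r(g) P⁻¹`
  refine ⟨c, ?_⟩
  have eψ : ((ψ : GL (Fin 2) k) : Matrix (Fin 2) (Fin 2) k) = c • ((P : GL (Fin 2) k) : Matrix (Fin 2) (Fin 2) k) := by
    have : ψ = P * (P⁻¹ * ψ) := by group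
    rw [this, Units.val_mul, hc, Matrix.mul_smul, Matrix.mul_one]
  have eg : r (θ g) = ψ * r g * P⁻¹ := by rw [hψ]; group
  rw [eg, Units.val_mul, Units.val_mul, eψ, Matrix.smul_mul, Matrix.smul_mul, Units.val_mul,
    Units.val_mul]

end Summit.Langlands.Langlands.Theorems.TensorSquareParallel

end
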